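import Summits.Langlands.Langlands.Theorems.PicardMuOrdinaryMuOrdinaryFamilyRTDefs
import Summits.Langlands.Langlands.Theorems.PicardMuOrdinaryMuOrdinaryFamilyRTSqueeze
import Summits.Langlands.Langlands.Theorems.PicardMuOrdinaryMuOrdinaryFamilyRTEndgame
import Summits.Langlands.Langlands.Theorems.PicardMuOrdinaryMuOrdinaryFamilyRTAccumulate
import Summits.Langlands.Langlands.Theorems.PicardMuOrdinaryMuOrdinaryFamilyRTPointOf
import Literature.NumberTheory.GaloisRepresentations.CarayolSerreDescentProofs
import Literature.NumberTheory.GaloisRepresentations.CarayolSerreLemmasProofs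

/-!
# Line `free-seed-smooth-rt` — registered skeleton v3 (lead) for the crux
`Summit.Langlands.Langlands.Theses.PicardMuOrdinary.MuOrdinaryFamilyRT` (stmt-Langlands-13757)

Lead `prover-line-stmt-Langlands-13757-0`, 2026-08-16, cycles 1–2.  Everything provable on this line so far has LANDED and
is imported above (all in namespace `Summit.Langlands.Langlands.Cruxes.MuOrdinaryFamilyRT.FreeSeedSmoothRt`):

* the vocabulary `K, Generic, ResidualHyp, LimitConclusion, crux_iff, badPrimes, picardC, Roots, rbar, IsUpper3,
  IsDistinguishedFlag, IsTypeDelta, UniversalRing, PointData, TangentLE3, SeedExists, HostData, PicardBorelAt3,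
  ResiduallyDistinguished, InScope` and the statements `S.stub_point/host/endgame/outOfScope`
  (`Theorems/PicardMuOrdinaryMuOrdinaryFamilyRTDefs.lean`, p82023, verbatim from the planner's checked skeleton v1);
* `stub_squeeze : S.stub_squeeze` — the Krull squeeze (p81791, `…Squeeze.lean`);
* `stub_endgame : S.stub_endgame` — the `ℚ̄₃`-norm ↔ `ℤ̄_𝔐` dictionary and the typed `LimitConclusion` (p84118, `…Endgame.lean`);
* `stub_accumulate : S.stub_accumulate` — points over nearby weights (p88508, `…Accumulate.lean`; uses `eT` through
  `IsDomain T`, regularity ⇒ UFD ⇒ normality of `𝒪⟦X,Y,Z⟧`, boundedness of points, and the sister line's landed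
  `CharZeroDominance.accumulation_domain`).

* `stub_point_of : F1 → F2 → F3 → S.stub_point` — THE PICARD POINT, conditional (p102431, `…PointOf.lean`, assembling 15 landed
  leaf files `…Point*.lean`): F1 = `Literature.….ordinaryPolarizedDeformationRing_nonempty` (GL_n ordinary+polarized Mazur–Ramakrishna–
  Tilouine representability; interface + named fact landed as `Literature/NumberTheory/GaloisRepresentations/OrdinaryPolarizedDeformationRing.lean`,
  p91188, UNDISCHARGED), F2/F3 = Carayol–Serre descent / "the character determines the representation" (`…/CarayolSerreLemmas.lean`,
  p91467) — BOTH ALREADY DISCHARGED in the tree (`…CarayolSerreDescentProofs`, `…CarayolSerreLemmasProofs`), so below `stub_point`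
  is closed MODULO the single named fact F1.

OPEN (sorried below, registered on the crux item): `stub_host` (THE HOST — Λ-adic ordinary Hida family of the definite `U(3)_{K/ℚ}` at
the ramified prime with Galois representations and classicality: crux-sized, no in-tree inhabitant and no citable published theorem at a
RAMIFIED prime — see the lead's `work/stub_host_analysis.md`), `stub_outOfScope` (the conceded remainder = the crux verbatim on `¬ InScope`;
audited: no junk vacuity either way).  Hence the line is CLOSED MODULO {F1 (named fact), stub_host, stub_outOfScope}: `MuOrdinaryFamilyRT_proof`
below takes `hF1` and the two sorried stubs.  The composition `MuOrdinaryFamilyRT_of` is unchanged from v1 (pure logic).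
Planner's v1 docstring (lever, shape, scope, conventions): `Lines/free-seed-smooth-rt.md` and git history of this file.
-/

namespace Summit.Langlands.Langlands.Cruxes.MuOrdinaryFamilyRT.FreeSeedSmoothRt

set_option linter.dupNamespace false

open scoped NumberField Polynomial Matrix Classical
open Field IsDedekindDomain Polynomial
open Literature.NumberTheory.GaloisRepresentations Literature.NumberTheory.Automorphic

noncomputable section

/-! ## 6'. The stubs: `stub_point` closed modulo the named fact F1; `stub_host`, `stub_outOfScope` OPEN (registered);
`stub_squeeze`, `stub_accumulate`, `stub_endgame` are the imported landed theorems -/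

/-- **The Picard point, modulo F1.**  `S.stub_point` from the landed conditional `stub_point_of` (p102431) and the tree's discharges of
F2 (`exists_descent_of_trace_mem_of_isAbsIrreducible_residual_holds`) and F3
(`exists_conj_eq_of_trace_eq_of_isAbsIrreducible_residual_holds`); the remaining hypothesis is the named fact
F1 = `ordinaryPolarizedDeformationRing_nonempty` (existence of the universal ordinary polarized deformation ring). -/
theorem stub_point (hF1 : Literature.NumberTheory.GaloisRepresentations.ordinaryPolarizedDeformationRing_nonempty) :
    S.stub_point :=
  stub_point_of hF1 Literature.NumberTheory.GaloisRepresentations.exists_descent_of_trace_mem_of_isAbsIrreducible_residual_holds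
    Literature.NumberTheory.GaloisRepresentations.exists_conj_eq_of_trace_eq_of_isAbsIrreducible_residual_holds

theorem stub_host : S.stub_host := by
  sorry

theorem stub_outOfScope : S.stub_outOfScope := by
  sorry

/-! ## 7. The composition: stubs ⟹ crux (kernel-checked, no sorry of its own) -/

theorem MuOrdinaryFamilyRT_of (h₁ : S.stub_point) (h₂ : S.stub_host) (h₃ : S.stub_squeeze)
    (h₄ : S.stub_accumulate) (h₅ : S.stub_endgame) (h₆ : S.stub_outOfScope) :
    Summit.Langlands.Langlands.Theses.PicardMuOrdinary.MuOrdinaryFamilyRT := by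
  refine crux_iff.mpr ?_
  intro f hcpt hdeg hsep hgal hres
  have hgen : Generic f := ⟨hdeg, hsep, hgal⟩
  by_cases hsc : InScope f hcpt
  · obtain ⟨ι, e, hBorel, hDist, hall⟩ := hsc
    obtain ⟨d⟩ := h₁ f ι e hgen hBorel hDist
    obtain ⟨hseed, s, hs⟩ := hall d
    obtain ⟨h⟩ := h₂ f hcpt ι e d hgen hseed
    -- the squeeze: `𝒪⟦X,Y,Z⟧ ≅ R_Δ ≅ T`
    obtain ⟨hsbij, hφbij⟩ :=
      h₃ d.𝒪 d.𝓡.R h.T s h.φ h.Λ hs h.φ_surjective h.Λ_injective h.Λ_finite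
    -- the Picard point, transported to `T`
    let φe : d.𝓡.R ≃+* h.T := RingEquiv.ofBijective (h.φ : d.𝓡.R →+* h.T) hφbij
    let x' : h.T →+* PadicAlgCl 3 := (d.j.comp (d.x : d.𝓡.R →+* d.𝒪)).comp φe.symm.toRingHom
    have hφe : ∀ r, φe.symm (h.φ r) = r := fun r ↦ φe.symm_apply_apply r
    have hx' : x'.comp h.φ.toRingHom = d.j.comp d.x.toRingHom := by
      ext r
      show d.j (d.x (φe.symm (h.φ r))) = d.j (d.x r)
      rw [hφe]
    have hxj : x'.comp (algebraMap d.𝒪 h.T) = d.j := by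
      ext a
      show d.j (d.x (φe.symm (algebraMap d.𝒪 h.T a))) = d.j a
      rw [← h.φ.commutes a, hφe, d.x.commutes a]
      rfl
    -- `T ≅ 𝒪⟦X,Y,Z⟧`
    let eT : MvPowerSeries (Fin 3) d.𝒪 ≃ₐ[d.𝒪] h.T :=
      AlgEquiv.ofBijective (h.φ.comp s) (hφbij.comp hsbij)
    -- arithmetic-weight points accumulate at the Picard point, and the endgame
    have hacc := h₄ d.𝒪 d.j d.j_injective d.j_comp h.T eT h.Λ h.Λ_injective h.Λ_finite x' hxj h.W
      (h.weightAccum x' hx')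
    exact h₅ f hcpt ι e d h x' hgen hx' hacc
  · exact h₆ f hcpt hgen hsc hres

/-- The crux from the stubs: conditional on the named fact F1 (`ordinaryPolarizedDeformationRing_nonempty`); sorries live only
inside `stub_host` and `stub_outOfScope`. -/
theorem MuOrdinaryFamilyRT_proof
    (hF1 : Literature.NumberTheory.GaloisRepresentations.ordinaryPolarizedDeformationRing_nonempty) :
    Summit.Langlands.Langlands.Theses.PicardMuOrdinary.MuOrdinaryFamilyRT :=
  MuOrdinaryFamilyRT_of (stub_point hF1) stub_host stub_squeeze stub_accumulate stub_endgame stub_outOfScope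


end

end Summit.Langlands.Langlands.Cruxes.MuOrdinaryFamilyRT.FreeSeedSmoothRt
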